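import Summits.AnomalousDissipation.AnomalousDissipation.Theorems.EnsembleRigidityDefs
import Summits.AnomalousDissipation.AnomalousDissipation.Theorems.TaylorCertificatesSteadyStatesLoudBoundedStubGpAdmissible
import Literature.Analysis.FluidPDE.StokesTorusProofs
import Literature.Analysis.FluidPDE.TorusForceBookkeeping
import Literature.Analysis.FunctionSpaces.LatticeGreenKernel

/-!
# Stub `stub_headModes` of line `Sketch` (crux stmt-AnomalousDissipation-15509,
  `EnsembleRigidity.GPMeanBoundedFamily`)

Tools stub S1 of the skeleton `Theorems/EnsembleRigidity/GPMeanBoundedFamily`: the two head modes of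
the line — the Galloway–Proctor force `f_GP = gpForce` and its Lamb mode `g = lambMode`
(`Theorems/EnsembleRigidityDefs`) — are admissible and `G`-symmetric, `G` the 24-element stabiliser of
`f_GP` generated by the coordinate 3-cycle `cycShift`, the inversion `y ↦ -y` and the twisted
half-turn `twistTurn` (`IsGPSymmetric`).

* Admissibility of `g = ½ Σ (six Stokes sine modes)`: each mode `sin(2π k·x) eᵢ` with `k` on the shell
  `|k|² = 2` and `kᵢ = 0` is smooth (`Torus.isSmooth_stokesMode`), divergence free since `k · eᵢ = 0`
  (`Torus.isDivFree_stokesMode`) and mean zero since `k ≠ 0` (`Torus.hasZeroMean_stokesMode`); the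
  three properties are additive on smooth fields (`GpAdmissible.isDivFree_add`,
  `GpAdmissible.hasZeroMean_add`) and stable under the constant factor `½`
  (`Torus.isDivFree_const_smul`, `Torus.hasZeroMean_const_smul`).
* Symmetry: in coordinates `f_GP = (s₂, s₀, s₁)` and `g = (s₁c₂, s₂c₀, s₀c₁)` with
  `sⱼ + i cⱼ`-data read off the characters `e(yⱼ) = fourier 1 (yⱼ)` (`sⱼ = Im e(yⱼ)`, `cⱼ = Re e(yⱼ)`);
  the generators act on the characters by `e(y_{j+1})` (cycle), `e(-yⱼ) = conj e(yⱼ)` (inversion;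
  the tree's `LatticeFourier.fourier_neg_arg`) and `e(yⱼ + ½) = -e(yⱼ)` (Mathlib's
  `fourier_add_half_inv_index`), after which each covariance clause is a sign identity between
  products of real and imaginary parts.
-/

noncomputable section

-- every `Summit.AnomalousDissipation.AnomalousDissipation.…` name repeats the summit = sub-problem segment (D-0017 layout)
set_option linter.dupNamespace false

namespace Summit.AnomalousDissipation.AnomalousDissipation.Theorems.EnsembleRigidity.GPMeanBoundedFamily

open Literature.Analysis.FunctionSpaces Literature.Analysis.FluidPDE
open Summit.AnomalousDissipation.AnomalousDissipation.Theorems.EnsembleRigidity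
open scoped ComplexConjugate

namespace StubHeadModes

/-! ## Admissibility of the Lamb pieces -/

/-- A Lamb sine mode `sin(2π k·x) eᵢ` with `k ≠ 0` and `kᵢ = 0` (so `k · eᵢ = 0`) is smooth,
divergence free and mean zero. [folklore] -/
theorem lambPiece_admissible {k : Fin 3 → ℤ} (hk : k ≠ 0) {i : Fin 3} (hki : k i = 0) :
    Torus.IsSmooth ⇑(Torus.stokesMode k (EuclideanSpace.single i (1 : ℝ)) false) ∧
      Torus.IsDivFree ⇑(Torus.stokesMode k (EuclideanSpace.single i (1 : ℝ)) false) ∧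
      Torus.HasZeroMean ⇑(Torus.stokesMode k (EuclideanSpace.single i (1 : ℝ)) false) :=
  ⟨Torus.isSmooth_stokesMode _ _ _,
    Torus.isDivFree_stokesMode
      (by simp [EuclideanSpace.inner_single_right, Torus.latticeVec_apply, hki]) _,
    Torus.hasZeroMean_stokesMode hk _ _⟩

/-! ## The characters under the generators of `G` -/

/-- The first character is odd under the half-period shift: `e(x + ½) = -e(x)` (Mathlib's
`fourier_add_half_inv_index` with `T = 1`, `n = 1`). [folklore] -/
theorem fourier_one_add_halfPeriod (x : UnitAddCircle) :
    fourier 1 (x + halfPeriod) = -fourier 1 x := by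
  have h := fourier_add_half_inv_index (T := 1) (n := 1) one_ne_zero one_pos x
  simpa [halfPeriod] using h

/-! ## The head modes in coordinates -/

/-- `(f_GP)₀(y) = sin(2πy₂) = Im e(y₂)`. [folklore] -/
theorem gpForce_apply_zero (y : UnitAddTorus (Fin 3)) : gpForce y 0 = (fourier 1 (y 2)).im := by
  simp [gpForce, Torus.stokesMode_apply, UnitAddTorus.mFourier_single, -fourier_apply]

/-- `(f_GP)₁(y) = sin(2πy₀) = Im e(y₀)`. [folklore] -/
theorem gpForce_apply_one (y : UnitAddTorus (Fin 3)) : gpForce y 1 = (fourier 1 (y 0)).im := by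
  simp [gpForce, Torus.stokesMode_apply, UnitAddTorus.mFourier_single, -fourier_apply]

/-- `(f_GP)₂(y) = sin(2πy₁) = Im e(y₁)`. [folklore] -/
theorem gpForce_apply_two (y : UnitAddTorus (Fin 3)) : gpForce y 2 = (fourier 1 (y 1)).im := by
  simp [gpForce, Torus.stokesMode_apply, UnitAddTorus.mFourier_single, -fourier_apply]

/-- `g₀(y) = sin(2πy₁) cos(2πy₂) = Im e(y₁) · Re e(y₂)` (product-to-sum on the two modes
`e₁ ± e₂`). [folklore] -/
theorem lambMode_apply_zero (y : UnitAddTorus (Fin 3)) :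
    lambMode y 0 = (fourier 1 (y 1)).im * (fourier 1 (y 2)).re := by
  simp [lambMode, Torus.stokesMode_apply, UnitAddTorus.mFourier, Fin.prod_univ_three, fourier_neg,
    fourier_zero, -fourier_apply, Complex.mul_im, Complex.conj_re, Complex.conj_im]
  ring

/-- `g₁(y) = sin(2πy₂) cos(2πy₀) = Im e(y₂) · Re e(y₀)` (modes `e₂ ± e₀`). [folklore] -/
theorem lambMode_apply_one (y : UnitAddTorus (Fin 3)) :
    lambMode y 1 = (fourier 1 (y 2)).im * (fourier 1 (y 0)).re := by
  simp [lambMode, Torus.stokesMode_apply, UnitAddTorus.mFourier, Fin.prod_univ_three, fourier_neg,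
    fourier_zero, -fourier_apply, Complex.mul_im, Complex.conj_re, Complex.conj_im]
  ring

/-- `g₂(y) = sin(2πy₀) cos(2πy₁) = Im e(y₀) · Re e(y₁)` (modes `e₀ ± e₁`). [folklore] -/
theorem lambMode_apply_two (y : UnitAddTorus (Fin 3)) :
    lambMode y 2 = (fourier 1 (y 0)).im * (fourier 1 (y 1)).re := by
  simp [lambMode, Torus.stokesMode_apply, UnitAddTorus.mFourier, Fin.prod_univ_three, fourier_neg,
    fourier_zero, -fourier_apply, Complex.mul_im, Complex.conj_re, Complex.conj_im]
  ring

/-! ## Symmetry of the head modes -/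

/-- The Galloway–Proctor force is `G`-symmetric: covariant under the coordinate 3-cycle, odd, and
transforming by `diag(1,-1,-1)` under the twisted half-turn. [folklore] -/
theorem isGPSymmetric_gpForce : IsGPSymmetric gpForce := by
  refine ⟨fun y i => ?_, fun y i => ?_, fun y => ?_⟩
  · fin_cases i <;>
      simp [gpForce_apply_zero, gpForce_apply_one, gpForce_apply_two, cycShift, -fourier_apply]
  · fin_cases i <;>
      simp [gpForce_apply_zero, gpForce_apply_one, gpForce_apply_two,
        LatticeFourier.fourier_neg_arg, -fourier_apply]
  · simp [gpForce_apply_zero, gpForce_apply_one, gpForce_apply_two, twistTurn,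
      LatticeFourier.fourier_neg_arg, fourier_one_add_halfPeriod, -fourier_apply]

/-- The Lamb mode is `G`-symmetric: covariant under the coordinate 3-cycle, odd, and transforming
by `diag(1,-1,-1)` under the twisted half-turn. [folklore] -/
theorem isGPSymmetric_lambMode : IsGPSymmetric lambMode := by
  refine ⟨fun y i => ?_, fun y i => ?_, fun y => ?_⟩
  · fin_cases i <;>
      simp [lambMode_apply_zero, lambMode_apply_one, lambMode_apply_two, cycShift, -fourier_apply]
  · fin_cases i <;>
      simp [lambMode_apply_zero, lambMode_apply_one, lambMode_apply_two,
        LatticeFourier.fourier_neg_arg, -fourier_apply]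
  · simp [lambMode_apply_zero, lambMode_apply_one, lambMode_apply_two, twistTurn,
      LatticeFourier.fourier_neg_arg, fourier_one_add_halfPeriod, -fourier_apply]

open Summit.AnomalousDissipation.AnomalousDissipation.Theorems.SteadyStatesLoudBounded.GpAdmissible in
/-- The Lamb mode is smooth, divergence free and mean zero (six admissible Stokes pieces,
additivity, and the constant factor `½`). [folklore] -/
theorem lambMode_admissible :
    Torus.IsSmooth lambMode ∧ Torus.IsDivFree lambMode ∧ Torus.HasZeroMean lambMode := by
  obtain ⟨h1s, h1d, h1z⟩ :=
    lambPiece_admissible (k := ![0, 1, 1]) (by decide) (i := (0 : Fin 3)) rfl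
  obtain ⟨h2s, h2d, h2z⟩ :=
    lambPiece_admissible (k := ![0, 1, -1]) (by decide) (i := (0 : Fin 3)) rfl
  obtain ⟨h3s, h3d, h3z⟩ :=
    lambPiece_admissible (k := ![1, 0, 1]) (by decide) (i := (1 : Fin 3)) rfl
  obtain ⟨h4s, h4d, h4z⟩ :=
    lambPiece_admissible (k := ![-1, 0, 1]) (by decide) (i := (1 : Fin 3)) rfl
  obtain ⟨h5s, h5d, h5z⟩ :=
    lambPiece_admissible (k := ![1, 1, 0]) (by decide) (i := (2 : Fin 3)) rfl
  obtain ⟨h6s, h6d, h6z⟩ :=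
    lambPiece_admissible (k := ![1, -1, 0]) (by decide) (i := (2 : Fin 3)) rfl
  have h12s := h1s.add h2s
  have h123s := h12s.add h3s
  have h1234s := h123s.add h4s
  have h12345s := h1234s.add h5s
  have h123456s := h12345s.add h6s
  have hd : Torus.IsDivFree
      (⇑(Torus.stokesMode ![0, 1, 1] (EuclideanSpace.single (0 : Fin 3) (1 : ℝ)) false) +
        ⇑(Torus.stokesMode ![0, 1, -1] (EuclideanSpace.single (0 : Fin 3) (1 : ℝ)) false) +
        ⇑(Torus.stokesMode ![1, 0, 1] (EuclideanSpace.single (1 : Fin 3) (1 : ℝ)) false) +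
        ⇑(Torus.stokesMode ![-1, 0, 1] (EuclideanSpace.single (1 : Fin 3) (1 : ℝ)) false) +
        ⇑(Torus.stokesMode ![1, 1, 0] (EuclideanSpace.single (2 : Fin 3) (1 : ℝ)) false) +
        ⇑(Torus.stokesMode ![1, -1, 0] (EuclideanSpace.single (2 : Fin 3) (1 : ℝ)) false)) :=
    isDivFree_add h12345s h6s (isDivFree_add h1234s h5s (isDivFree_add h123s h4s
      (isDivFree_add h12s h3s (isDivFree_add h1s h2s h1d h2d) h3d) h4d) h5d) h6d
  have hz : Torus.HasZeroMean
      (⇑(Torus.stokesMode ![0, 1, 1] (EuclideanSpace.single (0 : Fin 3) (1 : ℝ)) false) +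
        ⇑(Torus.stokesMode ![0, 1, -1] (EuclideanSpace.single (0 : Fin 3) (1 : ℝ)) false) +
        ⇑(Torus.stokesMode ![1, 0, 1] (EuclideanSpace.single (1 : Fin 3) (1 : ℝ)) false) +
        ⇑(Torus.stokesMode ![-1, 0, 1] (EuclideanSpace.single (1 : Fin 3) (1 : ℝ)) false) +
        ⇑(Torus.stokesMode ![1, 1, 0] (EuclideanSpace.single (2 : Fin 3) (1 : ℝ)) false) +
        ⇑(Torus.stokesMode ![1, -1, 0] (EuclideanSpace.single (2 : Fin 3) (1 : ℝ)) false)) :=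
    hasZeroMean_add h12345s h6s (hasZeroMean_add h1234s h5s (hasZeroMean_add h123s h4s
      (hasZeroMean_add h12s h3s (hasZeroMean_add h1s h2s h1z h2z) h3z) h4z) h5z) h6z
  exact ⟨h123456s.smul (1 / 2),
    Torus.isDivFree_const_smul (h123456s.isContDiff (by simp)) hd (1 / 2),
    Torus.hasZeroMean_const_smul hz (1 / 2)⟩

end StubHeadModes

/-- **S1 `stub_headModes`** (tools stub of line `Sketch`). The Lamb mode is smooth, divergence free
and mean zero (it is one half of a sum of six Stokes sine modes with `k · a = 0`, `k ≠ 0`), and both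
head modes `f_GP`, `g` are `G`-symmetric (direct check on the three generators of the stabiliser
of `f_GP`). [folklore] -/
theorem stub_headModes :
    (Torus.IsSmooth lambMode ∧ Torus.IsDivFree lambMode ∧ Torus.HasZeroMean lambMode) ∧
      IsGPSymmetric gpForce ∧ IsGPSymmetric lambMode :=
  ⟨StubHeadModes.lambMode_admissible, StubHeadModes.isGPSymmetric_gpForce,
    StubHeadModes.isGPSymmetric_lambMode⟩

end Summit.AnomalousDissipation.AnomalousDissipation.Theorems.EnsembleRigidity.GPMeanBoundedFamily

end
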